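import Summits.KontsevichZagierPeriods.Zeta5Search.LaiSweepShard

/-!
# `κ₃` sweep certificate — shard file 082 of 127 (shards 574–580 of 889)

HONEST FRAMING. Systematic search; no irrationality claim unless certified. This file only checks,
by `decide +kernel`, shards 574–580 of the order-cell sweep of the `κ₃` point `(74, 2180, 444; δ74)`
(engine `LaiSweepEngine`, soundness `LaiSweepJump/Free/Eval/Shard/Kappa3`; a shard is `⟨regime, n,
p, q, p', q', Lo, Up⟩`: `n` cells from `p/q` to `p'/q'` with integer rate sums in `[Lo, Up]`, `K =
128`, `D = 2^40`). It draws NO conclusion: only the capstone `LaiKappa3SweepCert`, which needs all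
127 shard files, does. Kernel cost of this file ≈ 560 cells × 0.3 s.
-/

namespace Summit.KontsevichZagierPeriods.Zeta5Search.Sweep

set_option maxHeartbeats 100000000 in
/-- Shard 574: 80 cells of regime B from `177/293` to `135/223`.
[cite: Lai2024BallRivoal, §4 Lemma 4.3] -/
theorem shard574 :
    Shard.check 128 (2^40)
      ⟨true, 80, 177, 293, 135, 223, 13500885423319, 17846301704772⟩ = true := by
  decide +kernel

set_option maxHeartbeats 100000000 in
/-- Shard 575: 80 cells of regime B from `135/223` to `165/272`.
[cite: Lai2024BallRivoal, §4 Lemma 4.3] -/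
theorem shard575 :
    Shard.check 128 (2^40)
      ⟨true, 80, 135, 223, 165, 272, 12961419502861, 17150674741259⟩ = true := by
  decide +kernel

set_option maxHeartbeats 100000000 in
/-- Shard 576: 80 cells of regime B from `165/272` to `200/329`.
[cite: Lai2024BallRivoal, §4 Lemma 4.3] -/
theorem shard576 :
    Shard.check 128 (2^40)
      ⟨true, 80, 165, 272, 200, 329, 13456947997858, 17824572003779⟩ = true := by
  decide +kernel

set_option maxHeartbeats 100000000 in
/-- Shard 577: 80 cells of regime B from `200/329` to `173/284`.
[cite: Lai2024BallRivoal, §4 Lemma 4.3] -/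
theorem shard577 :
    Shard.check 128 (2^40)
      ⟨true, 80, 200, 329, 173, 284, 13097659379244, 17366559864063⟩ = true := by
  decide +kernel

set_option maxHeartbeats 100000000 in
/-- Shard 578: 80 cells of regime B from `173/284` to `246/403`.
[cite: Lai2024BallRivoal, §4 Lemma 4.3] -/
theorem shard578 :
    Shard.check 128 (2^40)
      ⟨true, 80, 173, 284, 246, 403, 13230982313289, 17561220594310⟩ = true := by
  decide +kernel

set_option maxHeartbeats 100000000 in
/-- Shard 579: 80 cells of regime B from `246/403` to `63/103`.
[cite: Lai2024BallRivoal, §4 Lemma 4.3] -/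
theorem shard579 :
    Shard.check 128 (2^40)
      ⟨true, 80, 246, 403, 63, 103, 12809522065691, 17019198818746⟩ = true := by
  decide +kernel

set_option maxHeartbeats 100000000 in
/-- Shard 580: 80 cells of regime B from `63/103` to `19/31`.
[cite: Lai2024BallRivoal, §4 Lemma 4.3] -/
theorem shard580 :
    Shard.check 128 (2^40)
      ⟨true, 80, 63, 103, 19, 31, 13054410044551, 17361915360287⟩ = true := by
  decide +kernel

/-- The checked shards of this file, in order. [folklore] -/
def shards082 : List (CheckedShard 128 (2^40)) :=
  [⟨_, shard574⟩, ⟨_, shard575⟩, ⟨_, shard576⟩, ⟨_, shard577⟩, ⟨_, shard578⟩,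
    ⟨_, shard579⟩, ⟨_, shard580⟩]

end Summit.KontsevichZagierPeriods.Zeta5Search.Sweep
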